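import Summits.ValiantsHypothesis.ValiantsHypothesis.Theorems.EquivariantDialBudgetEmbedding
import Summits.ValiantsHypothesis.ValiantsHypothesis.Theorems.EquivariantDialThresholdYoung
import Summits.ValiantsHypothesis.ValiantsHypothesis.Theorems.EquivariantDialRateHeredity
import HarnessLib

/-!
# ValiantsHypothesis — the equivariant dial: THRESHOLD PERMIFY, file 4/5 — permify at polynomial
# loss `n^{O(τ)}` and the diagonal cell at NEAR-EXPONENTIAL RATE `2^{Ω(n / log n)}`

Helper of `stmt-ValiantsHypothesis-23702` (`--as helper`; 0 definitions, 0 named facts, closes NO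
item).  Decomposition workshop VALIANT, lens-1 («representation-theoretic obstruction splitting»),
g36, offer O-L1-28 «THRESHOLD PERMIFY».

Dial (tree `…EquivariantDialNode.lean`): `EqHard H = ¬ PolyEquivariant H`; the diagonal notch
`Δ𝔖_n = diagPermSubst n` (`…EquivariantDialDiagonalPermify.lean`).  State before this file: the
diagonal cell is known at RATE strength only through `diag_rate` (g35): `n ≤ a (L n + a)^D` i.o. for
families of sizes `≤ 2^{L n}`, with `D = d + 1` the UNCOMPUTED quasi-polynomial loss of `diag_permify`.

THIS FILE.
* `diag_permify_of_budget` — `diag_permify` transcribed at an arbitrary Young fixed-vector index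
  budget `B` (steps (i) `conjugationNormalForm_rename_sub`, (ii′) `finiteConjugationLift_sub`,
  (iii′)_Δ,B `diagRetract_of_budget`, (iv) `exists_permConj_extension`): size `m' ≤ m · 4m · B`, or the
  small regime `n ≤ 4 (log₂ m + 1)`.
* ★ `diag_permify_threshold` — PERMIFY AT POLYNOMIAL LOSS: for every threshold `τ`, a
  `Δ𝔖_n`-equivariant affine determinantal representation of `per_n` of size `m` yields one of size
  `≤ 4 m² (n+1)^{2τ}` with permutation lifts, unless `n ≤ 4 (log₂ m + 1)` or `2^{⌊τ/2⌋} ≤ 2m` — the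
  budget now comes from the THRESHOLD YOUNG DICHOTOMY (`youngFixedVector_threshold`, file 3, over the
  PROVED Literature fact `spechtDimDichotomy`) instead of the quasi-polynomial `youngFixedVector_holds`.
* ★★ `diag_rate_nearExp` — THE DIAGONAL CELL AT NEAR-EXPONENTIAL RATE: every family of
  `Δ𝔖_n`-equivariant affine determinantal representations of the permanents of sizes `≤ 2^{L n}`
  satisfies `n ≤ a (L n + 1)(log₂ n + 1)` for some `a` and infinitely many `n` — log-size
  `Ω(n / log n)` infinitely often (Grenet's equivariant upper bound is `2^n − 1`).  Chain: at
  `τ = 2 (L n + 2)` both escape disjuncts of `diag_permify_threshold` are impossible when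
  `4 (L n + 1) < n`, so the symmetric circuits of `stub_toSymmetricCircuit` have `≤ 2^{e X_n}` gates,
  `X_n = O((L n + 1)(log₂ n + 1))` (`threshold_size_bound`); Dawar–Wilsenach
  (`squareSymmetricPermLB_holds`) gives `2^{εn} ≤` gates i.o.
* ★ `nearExp_of_heredity` — the law of g35 (`rate_of_heredity`) at the new rate: head restriction
  along a diagonal reach `b` preserves sizes, so `n ≤ a (L (n + b n) + 1)(log₂ n + 1)` i.o.

HONEST BOUNDARY: 0 S-currency; closes NO item; `EqHard` conclusions are S-implied (S ⇒ W ⇒ EqHard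
H); the rate conclusion is a restricted-model lower bound of Dawar–Wilsenach class (equivariant =
symmetric model), not a statement about dc(per_m); permify is made POLYNOMIAL in the matrix size for
each fixed threshold τ (index budget (n+1)^{2τ}), but an irreducible block of dimension k still
forces τ > 2 log₂ k, so the total loss is n^{O(log s)} and the diagonal rate is 2^{Ω(n/log n)} i.o.,
NOT 2^{Ω(n)} (Grenet's upper bound 2^n − 1 is matched only up to the log); the residual sliver log₂
m/log₂ log₂ m ≲ t(m) ≲ log₂ m·log₂ log₂ m of diagonal heads (it contains t = log₂ m) stays
UNDECIDED · IDEA-NEEDED (needs poly(f^λ)-index fixed-vector subgroups for all λ, or an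
index-law-beating engine); F1/F2 and the budget forms of (H2)/(diag_permify) are budget-generic
TRANSCRIPTIONS of tree proofs, the new mathematics is the threshold dichotomy (from the PROVED
Literature fact spechtDimDichotomy) and the rate bookkeeping; P-ROW and the cyclic notches Δ⟨π⟩ of
superpolynomial order are NOT touched; stmt-23702 / VP ≠ VNP untouched.

LABEL (critic RULING + CALL GO, bus 3237, verbatim): «O-L1-28 (lens-1 g36): ELEMENTARY ·
NEW-COMBINATION leaning NEW-INPUT (the PROVED Literature theorem spechtDimDichotomy — James–Kerber
2.4.3/2.4.10 branching, a crude effective Rasala — pointed at equivariant determinantal symmetry for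
the first time, as a THRESHOLD Young dichotomy «a row/column side of λ has Young subgroup of index ≤
(n+1)^τ OR f^λ ≥ 2^{⌊τ/2⌋}» replacing the quasi-polynomial YoungDegreeBound budget × the g33–g35
permify / rate-heredity chain made budget-generic) · BEATS the 3118 polylog sliver: permify at
POLYNOMIAL loss (n+1)^{2τ} per fixed threshold τ, total n^{O(log s)}; diagonal RATE edc_Δ(per_n) ≥
2^{Ω(n/log n)} i.o. (restricted model, Dawar–Wilsenach class; Grenet's equivariant 2^n − 1 matched
up to the log in the exponent); heredity LAW threshold t ≫ log₂ m·log₂ log₂ m; EVERY polylog head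
Δ(𝔖_{(log₂ m)^E} ⊕ 1), E ≥ 2, HARD·KERNEL with NO uncomputed exponent (supersedes g35's E > D) · the
residual sliver log₂ m/log₂ log₂ m ≲ t ≲ log₂ m·log₂ log₂ m (contains t = log₂ m) stays
UNDECIDED · IDEA-NEEDED · P-ROW and cyclic notches untouched · 0 S-currency · closes NO item ·
VP ≠ VNP untouched»

Literature / delta.  [cite: DawarWilsenach2025, Thm. 7.1] (`2^{Ω(n)}` for `𝔖_n × 𝔖_n`-symmetric
CIRCUITS — the input, `squareSymmetricPermLB_holds`); [cite: LandsbergRessayre2017, Def. 1.3 /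
Question 2.2] and Landsberg, *Geometry and Complexity Theory* (2017) §7.4.1 p. 194 («I do not know just
how large the symmetry group needs to be to obtain an exponential bound») for EQUIVARIANT determinantal
complexity: here `Δ𝔖_n` alone forces `2^{Ω(n / log n)}` i.o. in the LR model; the Young threshold is a
crude effective form of Rasala's minimal-degree theorem (J. Algebra 45, 1977), in the tree as
`spechtDimDichotomy` (James–Kerber 2.4).  Reused BY NAME: `diag_permify` (bad `n` only),
`stub_toSymmetricCircuit`, `squareSymmetricPermLB_holds`, `two_pow_add_two_pow_le`,
`hasEquivariantDetRepr_head`, `diagPermSubst_eq_map`, `diagPermSubst_eq_closure_pairs`.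
-/

set_option linter.dupNamespace false

noncomputable section

namespace Summit.ValiantsHypothesis.ValiantsHypothesis.Theorems.EquivariantDialThresholdPermify

open MvPolynomial Matrix Literature.Computability.AlgebraicComplexity
open Summit.ValiantsHypothesis.ValiantsHypothesis.Theses
open Summit.ValiantsHypothesis.ValiantsHypothesis.Theorems.EquivariantDialNode
open Summit.ValiantsHypothesis.ValiantsHypothesis.Theorems.EquivariantDialPolyIndex
open Summit.ValiantsHypothesis.ValiantsHypothesis.Theorems.EquivariantDialDiagonalPermify
open Summit.ValiantsHypothesis.ValiantsHypothesis.Theorems.EquivariantDialRateHeredity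
open Summit.ValiantsHypothesis.ValiantsHypothesis.Theorems.SymPencilEquivariantSdcNotQP.Closer

/-! ## §1 Diagonal permify at an arbitrary budget, and at the threshold budget -/

/-- **Diagonal permify at budget `B`** — transcription of `diag_permify`: (i)
`conjugationNormalForm_rename_sub` and (ii′) `finiteConjugationLift_sub` over the diagonal subgroup of
pairs (`m₀ ≤ m`), (iii′)_Δ,B `diagRetract_of_budget` (the Young fixed-vector hypothesis restricted to
`k ≤ m₀ ≤ m`), (iv) `exists_permConj_extension`; the small regime `n ≤ 4 (log₂ m₀ + 1) ≤ 4 (log₂ m + 1)`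
is carried as a disjunct. [folklore; transcription] -/
theorem diag_permify_of_budget (n m B : ℕ)
    (A : Matrix (Fin m) (Fin m) (MvPolynomial (Fin n × Fin n) ℂ))
    (hA : IsEquivariantDetRepr (diagPermSubst n) (perPoly (Fin n) ℂ) A)
    (hY : ∀ k : ℕ, 1 ≤ k → k ≤ m →
      ∀ σ : ↥(alternatingGroup (Fin n)) × ↥(alternatingGroup (Fin n)) →* GL (Fin k) ℂ,
      ∃ Y : Subgroup (↥(alternatingGroup (Fin n)) × ↥(alternatingGroup (Fin n))),
        Y.index ≤ B ∧ ∃ ℓ : (Fin k → ℂ) →ₗ[ℂ] ℂ, ℓ ≠ 0 ∧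
          ∀ y ∈ Y, ℓ ∘ₗ Matrix.toLin' (σ y : Matrix (Fin k) (Fin k) ℂ) = ℓ) :
    n ≤ 4 * (Nat.log 2 m + 1) ∨ ∃ m' ≤ m * (4 * m * B),
      ∃ A' : Matrix (Fin m') (Fin m') (MvPolynomial (Fin n × Fin n) ℂ),
        IsAffineDetRepr (perPoly (Fin n) ℂ) A' ∧
        ∀ σ : Equiv.Perm (Fin n), ∃ τ : Equiv.Perm (Fin m'),
          A'.map (MvPolynomial.rename fun ij : Fin n × Fin n => (σ ij.1, σ ij.2)) =
            (τ.permMatrix ℂ).map MvPolynomial.C * A' * ((τ.permMatrix ℂ)ᵀ).map MvPolynomial.C := by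
  classical
  -- the diagonal subgroup of pairs
  let Δ : Subgroup (Equiv.Perm (Fin n) × Equiv.Perm (Fin n)) :=
    ((MonoidHom.id (Equiv.Perm (Fin n))).prod (MonoidHom.id (Equiv.Perm (Fin n)))).range
  have hmemΔ : ∀ σ : Equiv.Perm (Fin n), (σ, σ) ∈ Δ := fun σ => ⟨σ, rfl⟩
  have hA' : IsEquivariantDetRepr (Subgroup.closure {γ : GL (Fin n × Fin n) ℂ |
      ∃ πρ ∈ Δ, (γ : Matrix (Fin n × Fin n) (Fin n × Fin n) ℂ) =
        Equiv.Perm.permMatrix ℂ (Equiv.prodCongr πρ.1 πρ.2)}) (perPoly (Fin n) ℂ) A := by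
    rw [← diagPermSubst_eq_closure_pairs]
    exact hA
  -- step (i): conjugation normal form over the diagonal subgroup
  obtain ⟨B₁, hB₁, hBJ, hgen⟩ :=
    SymPencilEquivariantSdcNotQP.conjugationNormalForm_rename_sub n m Δ A hA'
  -- step (ii′): finite conjugation lift over the diagonal subgroup
  obtain ⟨m₀, hm₀, B₀, F, hB₀, hsurj, hscal, hdet, hliftF⟩ :=
    SymPencilEquivariantSdcNotQP.finiteConjugationLift_sub n m Δ B₁ hB₁ hBJ hgen
  -- step (iii′)_Δ,B: permutation embedding over the diagonal at budget `B`
  rcases diagRetract_of_budget n m₀ B F (fun σ => hsurj (σ, σ) (hmemΔ σ)) hscal hdet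
      (fun k hk1 hkm σA => hY k hk1 (hkm.trans hm₀) σA) with hsm | ⟨m', hm', ι, p, τ, hpι, hrel⟩
  · exact Or.inl (hsm.trans (Nat.mul_le_mul_left _ (Nat.succ_le_succ (Nat.log_mono_right hm₀))))
  -- step (iv): extension by the identity
  obtain ⟨A', hA'deg, hA'det, hA'perm⟩ := SymPencilEquivariantSdcNotQP.exists_permConj_extension
    (fun σ : Equiv.Perm (Fin n) =>
      MvPolynomial.rename fun ij : Fin n × Fin n => (σ ij.1, σ ij.2))
    B₀ hB₀.1 ι p hpι (fun σ => by
      obtain ⟨g, hg⟩ := hsurj (σ, σ) (hmemΔ σ)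
      exact ⟨g, τ ((σ, σ), g), hliftF ((σ, σ), g) hg, (hrel σ g hg).1, (hrel σ g hg).2⟩)
  refine Or.inr ⟨m', ?_, A', ⟨hA'deg, hA'det.trans hB₀.2⟩, fun σ => hA'perm σ⟩
  calc m' ≤ m₀ * (4 * m₀ * B) := hm'
    _ ≤ m * (4 * m * B) :=
        Nat.mul_le_mul hm₀ (Nat.mul_le_mul_right _ (Nat.mul_le_mul_left _ hm₀))

/-- ★ **THRESHOLD PERMIFY — permify at polynomial loss.**  For every threshold `τ`: a
`Δ𝔖_n`-equivariant (exact `GL × GL` lifts) affine determinantal representation of `per_n` of size `m`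
yields one of size `m' ≤ m · 4m · (n+1)^τ (n+1)^τ` on which every diagonal substitution is undone by a
permutation conjugation — unless `n ≤ 4 (log₂ m + 1)` (small regime of the spin dichotomy) or
`2^{⌊τ/2⌋} ≤ 2m` (threshold too low for the blocks).  `diag_permify_of_budget` fed by
`youngFixedVector_threshold`. [folklore; cite: LandsbergRessayre2017, Def. 1.3] -/
theorem diag_permify_threshold (n m τ : ℕ)
    (A : Matrix (Fin m) (Fin m) (MvPolynomial (Fin n × Fin n) ℂ))
    (hA : IsEquivariantDetRepr (diagPermSubst n) (perPoly (Fin n) ℂ) A) :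
    n ≤ 4 * (Nat.log 2 m + 1) ∨ 2 ^ (τ / 2) ≤ 2 * m ∨
      ∃ m' ≤ m * (4 * m * ((n + 1) ^ τ * (n + 1) ^ τ)),
        ∃ A' : Matrix (Fin m') (Fin m') (MvPolynomial (Fin n × Fin n) ℂ),
          IsAffineDetRepr (perPoly (Fin n) ℂ) A' ∧
          ∀ σ : Equiv.Perm (Fin n), ∃ τ' : Equiv.Perm (Fin m'),
            A'.map (MvPolynomial.rename fun ij : Fin n × Fin n => (σ ij.1, σ ij.2)) =
              (τ'.permMatrix ℂ).map MvPolynomial.C * A' * ((τ'.permMatrix ℂ)ᵀ).map MvPolynomial.C := by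
  by_cases h : 2 ^ (τ / 2) ≤ 2 * m
  · exact Or.inr (Or.inl h)
  rcases diag_permify_of_budget n m ((n + 1) ^ τ * (n + 1) ^ τ) A hA (fun k hk1 hkm σA =>
      (youngFixedVector_threshold n τ k σA hk1).resolve_left fun h' => h (h'.trans (by omega)))
    with h1 | h3
  · exact Or.inl h1
  · exact Or.inr (Or.inr h3)

/-! ## §2 The diagonal cell at near-exponential rate -/

/-- Budget arithmetic of the threshold chain: `s ≤ 2^L`, `n + 1 ≤ 2^{l+1}`,
`m' ≤ s · 4s · (n+1)^τ (n+1)^τ` give `(m' + 2)^e ≤ 2^{e (2L + 2(l+1)τ + 4)}`. [folklore] -/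
theorem threshold_size_bound {s L l n τ m' : ℕ} (e : ℕ) (hs : s ≤ 2 ^ L)
    (hn : n + 1 ≤ 2 ^ (l + 1)) (hm' : m' ≤ s * (4 * s * ((n + 1) ^ τ * (n + 1) ^ τ))) :
    (m' + 2) ^ e ≤ 2 ^ (e * (2 * L + 2 * (l + 1) * τ + 4)) := by
  have hP : (n + 1) ^ τ ≤ 2 ^ ((l + 1) * τ) := by
    rw [pow_mul]
    exact Nat.pow_le_pow_left hn τ
  have hk : m' ≤ 2 ^ (2 * L + 2 * (l + 1) * τ + 2) :=
    calc m' ≤ s * (4 * s * ((n + 1) ^ τ * (n + 1) ^ τ)) := hm'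
      _ ≤ 2 ^ L * (4 * 2 ^ L * (2 ^ ((l + 1) * τ) * 2 ^ ((l + 1) * τ))) :=
          Nat.mul_le_mul hs (Nat.mul_le_mul (Nat.mul_le_mul_left _ hs) (Nat.mul_le_mul hP hP))
      _ = 2 ^ (2 * L + 2 * (l + 1) * τ + 2) := by ring
  calc (m' + 2) ^ e ≤ (2 ^ (2 * L + 2 * (l + 1) * τ + 2) + 2) ^ e :=
        Nat.pow_le_pow_left (by omega) e
    _ ≤ 2 ^ (e * (2 * L + 2 * (l + 1) * τ + 2 + 2)) := two_pow_add_two_pow_le _ e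
    _ = 2 ^ (e * (2 * L + 2 * (l + 1) * τ + 4)) := by ring_nf

/-- ★★ **THE DIAGONAL CELL AT NEAR-EXPONENTIAL RATE.**  Every family of `Δ𝔖_n`-equivariant (exact
`GL × GL` lifts) affine determinantal representations of the permanents of sizes `≤ 2^{L n}` satisfies
`n ≤ a (L n + 1) (log₂ n + 1)` for some `a` and infinitely many `n` — log-size `Ω(n / log n)`
infinitely often.  For `n` with `4 (L n + 1) < n`, `diag_permify_threshold` at `τ = 2 (L n + 2)`
succeeds (both escapes are impossible) at size `≤ 2^{2 L n + 2 (log₂ n + 1) τ + 2}`, so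
`stub_toSymmetricCircuit` gives `𝔖_n`-symmetric circuits with `≤ 2^{e X_n}` gates; for the other `n` the
quasi-polynomial `diag_permify` supplies SOME symmetric circuit; Dawar–Wilsenach on the whole family.
Restricted-model lower bound; 0 S-currency; closes NO item.
[cite: DawarWilsenach2025, Thm. 7.1] [cite: LandsbergRessayre2017, Question 2.2] -/
theorem diag_rate_nearExp : ∀ L : ℕ → ℕ,
    (∀ n, ∃ s ≤ 2 ^ L n, HasEquivariantDetRepr (diagPermSubst n) (perPoly (Fin n) ℂ) s) →
    ∃ a : ℕ, ∀ n₀ : ℕ, ∃ n ≥ n₀, n ≤ a * (L n + 1) * (Nat.log 2 n + 1) := by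
  intro L hL
  obtain ⟨d, hd⟩ := diag_permify
  obtain ⟨e, he⟩ := SymPencilEquivariantSdcNotQP.stub_toSymmetricCircuit
  have h₃ : ProofCarryingSymmetry.SquareSymmetricPermLB := squareSymmetricPermLB_holds
  -- Step 1: symmetric circuits for every `n`; of size `2^{e X_n}` whenever `4 (L n + 1) < n`
  have key : ∀ n : ℕ, ∃ (G : Type) (_ : Fintype G)
      (C : LabelledArithCircuit ℂ (Fin n × Fin n) Unit G),
      C.IsSymmetric (Equiv.Perm (Fin n)) ∧ C.eval (C.output ()) = perPoly (Fin n) ℂ ∧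
        (4 * (L n + 1) < n → Fintype.card G ≤
          2 ^ (e * (2 * L n + 2 * (Nat.log 2 n + 1) * (2 * (L n + 2)) + 4))) := by
    intro n
    obtain ⟨s, hs, A, hA⟩ := hL n
    have hlog : Nat.log 2 s ≤ L n :=
      (Nat.log_mono_right hs).trans_eq (Nat.log_pow Nat.one_lt_two _)
    rcases Nat.lt_or_ge (4 * (L n + 1)) n with hgood | hbad
    · rcases diag_permify_threshold n s (2 * (L n + 2)) A hA with h1 | h2 | ⟨m', hm', A', hA', hperm⟩
      · exfalso
        have : n ≤ 4 * (L n + 1) := h1.trans (Nat.mul_le_mul_left _ (Nat.succ_le_succ hlog))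
        omega
      · exfalso
        rw [Nat.mul_div_cancel_left (L n + 2) Nat.two_pos, pow_add] at h2
        norm_num at h2
        have h1s : 1 ≤ 2 ^ L n := Nat.one_le_two_pow
        have := h2.trans (Nat.mul_le_mul_left 2 hs)
        omega
      · obtain ⟨G, hG, C, hCs, hCe, hcard⟩ := he n m' A' hA' hperm
        exact ⟨G, hG, C, hCs, hCe, fun _ => hcard.trans
          (threshold_size_bound e hs (Nat.lt_pow_succ_log_self Nat.one_lt_two n) hm')⟩
    · obtain ⟨s', -, A', hA', hperm⟩ := hd n s A hA
      obtain ⟨G, hG, C, hCs, hCe, -⟩ := he n s' A' hA' hperm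
      exact ⟨G, hG, C, hCs, hCe, fun h => absurd h (not_lt.mpr hbad)⟩
  choose G hG C hCs hCe hcard using key
  obtain ⟨ε, hε, hio⟩ := @h₃ G hG C hCs hCe
  -- Step 2: along Dawar–Wilsenach's infinite set, `ε n ≤ e X_n` (or `n` is small outright)
  refine ⟨12 * ⌈(e : ℝ) / ε⌉₊ + 4, fun n₀ => ?_⟩
  obtain ⟨n, hn, hbig⟩ := hio n₀
  refine ⟨n, hn, ?_⟩
  rcases Nat.lt_or_ge (4 * (L n + 1)) n with hgood | hbad
  swap
  · calc n ≤ 4 * (L n + 1) := hbad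
      _ ≤ (12 * ⌈(e : ℝ) / ε⌉₊ + 4) * (L n + 1) := Nat.mul_le_mul_right _ (by omega)
      _ = (12 * ⌈(e : ℝ) / ε⌉₊ + 4) * (L n + 1) * 1 := (mul_one _).symm
      _ ≤ (12 * ⌈(e : ℝ) / ε⌉₊ + 4) * (L n + 1) * (Nat.log 2 n + 1) :=
          Nat.mul_le_mul_left _ (by omega)
  set X : ℕ := 2 * L n + 2 * (Nat.log 2 n + 1) * (2 * (L n + 2)) + 4 with hX
  have hsizeR : (Fintype.card (G n) : ℝ) ≤ (2 : ℝ) ^ (((e * X : ℕ)) : ℝ) := by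
    rw [Real.rpow_natCast]
    exact_mod_cast hcard n hgood
  have hchain := (Real.rpow_le_rpow_left_iff one_lt_two).1 (hbig.trans hsizeR)
  have hnR : (n : ℝ) ≤ (⌈(e : ℝ) / ε⌉₊ : ℝ) * ((X : ℕ) : ℝ) := by
    have h1 : (n : ℝ) ≤ ((e * X : ℕ) : ℝ) / ε := by
      rw [le_div_iff₀ hε]
      linarith
    have h2 : ((e * X : ℕ) : ℝ) / ε = (e : ℝ) / ε * ((X : ℕ) : ℝ) := by
      push_cast
      ring
    rw [h2] at h1
    exact h1.trans (mul_le_mul_of_nonneg_right (Nat.le_ceil _) (by positivity))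
  have hnN : n ≤ ⌈(e : ℝ) / ε⌉₊ * X := by exact_mod_cast hnR
  have hXle : X ≤ 12 * ((L n + 1) * (Nat.log 2 n + 1)) := by
    rw [hX]
    nlinarith [Nat.zero_le (L n * Nat.log 2 n), Nat.zero_le (L n), Nat.zero_le (Nat.log 2 n)]
  calc n ≤ ⌈(e : ℝ) / ε⌉₊ * X := hnN
    _ ≤ ⌈(e : ℝ) / ε⌉₊ * (12 * ((L n + 1) * (Nat.log 2 n + 1))) := Nat.mul_le_mul_left _ hXle
    _ = 12 * ⌈(e : ℝ) / ε⌉₊ * (L n + 1) * (Nat.log 2 n + 1) := by ring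
    _ ≤ (12 * ⌈(e : ℝ) / ε⌉₊ + 4) * (L n + 1) * (Nat.log 2 n + 1) :=
        Nat.mul_le_mul_right _ (Nat.mul_le_mul_right _ (by omega))

/-! ## §3 The law at the new rate -/

/-- ★ **NEAR-EXPONENTIAL RATE HEREDITY.**  Head restriction along a diagonal reach `b` preserves
sizes (`hasEquivariantDetRepr_head`), so a `K`-equivariant family of sizes `≤ 2^{L m}` forces
`n ≤ a (L (n + b n) + 1)(log₂ n + 1)` infinitely often. [folklore; cite: LandsbergRessayre2017, Question 2.2] -/
theorem nearExp_of_heredity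
    (K : ∀ m : ℕ, Subgroup (Equiv.Perm (Fin m) × Equiv.Perm (Fin m))) (b L : ℕ → ℕ)
    (hK : ∀ n, ((⊤ : Subgroup (Equiv.Perm (Fin n))).map (diagHom n)).map
      ((headExt n (b n)).prodMap (headExt n (b n))) ≤ K (n + b n))
    (hL : ∀ m, ∃ s ≤ 2 ^ L m, HasEquivariantDetRepr ((K m).map (biPermHom m)) (perPoly (Fin m) ℂ) s) :
    ∃ a : ℕ, ∀ n₀ : ℕ, ∃ n ≥ n₀, n ≤ a * (L (n + b n) + 1) * (Nat.log 2 n + 1) := by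
  refine diag_rate_nearExp (fun n => L (n + b n)) fun n => ?_
  obtain ⟨s, hs, hA⟩ := hL (n + b n)
  refine ⟨s, hs, ?_⟩
  rw [diagPermSubst_eq_map]
  exact hasEquivariantDetRepr_head n (b n) _ (Subgroup.map_mono (hK n)) hA

end Summit.ValiantsHypothesis.ValiantsHypothesis.Theorems.EquivariantDialThresholdPermify

end
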